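import Summits.HubbardSuperconductivity.HubbardSuperconductivity.Theorems.AnisotropyChordTransferFibre3N1RowObjA
import Summits.HubbardSuperconductivity.HubbardSuperconductivity.Theorems.AnisotropyChordTransferFibre3N1RowExprB2

/-!
# Route `AnisotropyChord` / H0 rotor rung, LEVEL 2 row `N₁`: the OBJECT `B̂ = θ⁶Σ_k F₂(k)² F₂(k + K₁)` lies in its `RExpr` bracket

Third instance of the object layer of the cell-check soundness (after `…N1RowObjP.pHat_mem`, `…N1RowObjA.aHat_mem`): for a
ground two-magnon profile (`L ≥ 16`, `0 ≤ Δ < 1`) and the true vector `X = xTrue L Δ λ₂ f a` (`a = Δf(x̂)`),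
★ `bHat_mem`: `(B2loC 2).eval X ≤ θ⁶·Σ_k F₂(k)² F₂(k + K₁) ≤ (B2hiC 2).eval X` — for the CORRECTED bracket of `…N1RowExprB2`
(the landed `…N1RowExprB.B2lo/B2hi` carry a spurious factor `t` in the last summand of `BclosedFull`, found here).
The PAIR template: region split `𝕋 = {0} ⊔ {−K₁} ⊔ blockP ⊔ outerP` (`OuterMaj.pairRegionSplit_holds`), the list ↔ Finset bridge
for the pair block (`mem_blockP_two_iff`, `blockP_sum_eq`, the shift `toTor (q₁ + 1, q₂) = toTor q + K₁`), the two special points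
(`eval_F0h`, `eval_Fh` at `(±1, 0)`), the closed outer part `θ⁶Σ_{T′}c²c′ − θ⁶Σ_{blockP}c²c′` (`bClosedExpansion_holds` hatted:
`eval_BclosedFullC`), and the outer tail `|θ⁶Σ_{outerP}(F₂²F₂′ − c²c′)| ≤ BtailFull − Σ_{blockP} BtailAt` (`OuterMaj.b_outer_bound`
with the repaired slope `κ̂′ = kap.eval X`, `kap_eval`; the two-propagator sums over `T′` in named form: `sum_torPrime_bMaj`).
Prover seat `hubbard-h0-rotor-p2` g5; helper for piece A = stmt-HubbardSuperconductivity-23918 of rung 19089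
(`--supports`, helper class).  Nothing here proves superconductivity in the Hubbard model; helper lemmas of ONE conditional
reduction (the GM₃ ∀L certificate, Level-2 row `N₁`); the rotor TARGET as originally worded stays FALSE (g15 verdict).
Mathlib + the tree only; no sorry.
-/

set_option linter.dupNamespace false
set_option autoImplicit false

open Literature.Analysis.ValidatedNumerics

namespace Summit.HubbardSuperconductivity.HubbardSuperconductivity.Theorems.AnisotropyChord.Transfer.Fibre3.L2.N1

variable (L : ℕ) [NeZero L] (Δ lam2 : ℝ) (f : Tor L → ℝ)

/-- the `B` tail majorant per momentum (`OuterMaj.b_outer_bound` summand):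
`κ′(2|c||c′|g + |c|²g′) + κ′²(g²|c′| + 2|c|gg′) + κ′³g²g′`, `|c| = 2c_sg + d`, `g′ = g(k + K₁)`. -/
noncomputable def bMaj (k : Tor L) : ℝ :=
  let κ := kapHat L Δ lam2 f 2 + 2 * aPar L Δ f * cS L Δ lam2 f / (L : ℝ) ^ 2
  let ac := 2 * cS L Δ lam2 f * gres L lam2 k + dPar L Δ f
  let ac' := 2 * cS L Δ lam2 f * gres L lam2 (k + K1 L) + dPar L Δ f
  κ * (2 * ac * ac' * gres L lam2 k + ac ^ 2 * gres L lam2 (k + K1 L))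
    + κ ^ 2 * (gres L lam2 k ^ 2 * ac' + 2 * ac * gres L lam2 k * gres L lam2 (k + K1 L))
    + κ ^ 3 * gres L lam2 k ^ 2 * gres L lam2 (k + K1 L)

/-! ## The pair block: list ↔ Finset -/

/-- membership in the list `blockP 2`. -/
theorem mem_blockP_two_iff (q : ℤ × ℤ) :
    q ∈ blockP 2 ↔ (-3 ≤ q.1 ∧ q.1 ≤ 2) ∧ (-2 ≤ q.2 ∧ q.2 ≤ 2) ∧ q ≠ (0, 0) ∧ q ≠ (-1, 0) := by
  constructor
  · intro h; revert q; decide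
  · rintro ⟨⟨h1a, h1b⟩, ⟨h2a, h2b⟩, h0, h1⟩
    have key : ∀ a b : ℤ, -3 ≤ a → a ≤ 2 → -2 ≤ b → b ≤ 2 → (a, b) ≠ (0, 0) → (a, b) ≠ (-1, 0) →
        (a, b) ∈ blockP 2 := by
      intro a b h1 h2 h3 h4
      interval_cases a <;> interval_cases b <;> decide
    exact key q.1 q.2 h1a h1b h2a h2b h0 h1

/-- the list `blockP 2` has no duplicates. -/
theorem blockP_two_nodup : (blockP 2).Nodup := by decide

/-- pair-block points and their shifts are grid points of `M = 3`. -/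
theorem blockP_two_grid : ∀ q ∈ blockP 2, q ∈ gridPts 3 ∧ (q.1 + 1, q.2) ∈ gridPts 3 := by decide

/-- `(±1, 0)` are grid points. -/
theorem axis_mem_gridPts_three : ((1 : ℤ), (0 : ℤ)) ∈ gridPts 3 ∧ ((-1 : ℤ), (0 : ℤ)) ∈ gridPts 3 := by decide

omit [NeZero L] in
/-- the shift by `x̂`: `toTor (q₁ + 1, q₂) = toTor q + K₁`. -/
theorem toTor_shift (q : ℤ × ℤ) : B1.toTor L (q.1 + 1, q.2) = B1.toTor L q + K1 L := by
  rw [show ((q.1 + 1, q.2) : ℤ × ℤ) = q + ((1 : ℤ), (0 : ℤ)) from Prod.ext (by simp) (by simp), B1.toTor_add,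
    ClosedExp.toTor_one_zero]

/-- ★ a sum over the Finset `blockP L 2` is the list sum over `blockP 2` (`L ≥ 7`). -/
theorem blockP_sum_eq (hL : 7 ≤ L) (φ : Tor L → ℝ) :
    ∑ k ∈ Fibre3.blockP L 2, φ k = ((blockP 2).map fun q => φ (B1.toTor L q)).sum := by
  classical
  have hF : ((Finset.Icc (-((2 : ℕ) : ℤ) - 1) ((2 : ℕ) : ℤ) ×ˢ Finset.Icc (-((2 : ℕ) : ℤ)) ((2 : ℕ) : ℤ)).erase (0, 0)).erase
      (-1, 0) = (blockP 2).toFinset := by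
    ext q
    rw [Finset.mem_erase, Finset.mem_erase, Finset.mem_product, Finset.mem_Icc, Finset.mem_Icc, List.mem_toFinset,
      mem_blockP_two_iff]
    constructor
    · rintro ⟨h1, h0, ⟨h1a, h1b⟩, ⟨h2a, h2b⟩⟩
      exact ⟨⟨by push_cast at h1a; omega, by push_cast at h1b; omega⟩,
        ⟨by push_cast at h2a; omega, by push_cast at h2b; omega⟩, h0, h1⟩
    · rintro ⟨⟨h1a, h1b⟩, ⟨h2a, h2b⟩, h0, h1⟩
      exact ⟨h1, h0, ⟨by push_cast; omega, by push_cast; omega⟩, ⟨by push_cast; omega, by push_cast; omega⟩⟩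
  unfold Fibre3.blockP
  rw [hF, Finset.sum_image]
  · rw [List.sum_toFinset _ blockP_two_nodup]
  · intro p hp q hq hpq
    rw [Finset.mem_coe, List.mem_toFinset] at hp hq
    have hp' : p ∈ B1.box 3 := by
      rw [B1.mem_box_iff]; have := (mem_blockP_two_iff p).1 hp; push_cast; omega
    have hq' : q ∈ B1.box 3 := by
      rw [B1.mem_box_iff]; have := (mem_blockP_two_iff q).1 hq; push_cast; omega
    have := congrArg (B1.rep L) hpq
    rwa [B1.rep_toTor_of_mem_box L 3 (by omega) p hp', B1.rep_toTor_of_mem_box L 3 (by omega) q hq'] at this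

/-- ★ a sum over `outerP L 2` = the sum over `T′` minus the pair-block sum (`L ≥ 7`). -/
theorem outerP_sum_eq (hL : 7 ≤ L) (φ : Tor L → ℝ) :
    ∑ k ∈ Fibre3.outerP L 2, φ k = ∑ k ∈ torPrime L, φ k - ∑ k ∈ Fibre3.blockP L 2, φ k := by
  have h1 := OuterMaj.pairRegionSplit_holds L 2 (by omega) φ
  have h2 := ClosedExp.sum_torPrime L (by omega) φ
  linarith

/-! ## Two-propagator sums over `T′` -/

/-- the five elementary sums over `T′`: `Σ g²g′ = G21`, `Σ g² = S₂ − g₁²`, `Σ gg′ = T10`, `Σ g = Σ g′ = S₁ − g₁`. -/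
theorem sum_torPrime_basic (hL : 2 ≤ L) :
    (∑ k ∈ torPrime L, gres L lam2 k ^ 2 * gres L lam2 (k + K1 L)) = G21n L lam2 ∧
    (∑ k ∈ torPrime L, gres L lam2 k ^ 2) = S2n L lam2 - gres L lam2 (K1 L) ^ 2 ∧
    (∑ k ∈ torPrime L, gres L lam2 k * gres L lam2 (k + K1 L)) = T10n L lam2 ∧
    (∑ k ∈ torPrime L, gres L lam2 k) = S1n L lam2 - gres L lam2 (K1 L) ∧
    (∑ k ∈ torPrime L, gres L lam2 (k + K1 L)) = S1n L lam2 - gres L lam2 (K1 L) := by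
  refine ⟨?_, ?_, ?_, ?_, ?_⟩
  · rw [ClosedExp.sum_torPrime L hL, ClosedExp.G21n_eq, ClosedExp.gres_zero, neg_add_cancel, ClosedExp.gres_zero]; ring
  · rw [ClosedExp.sum_torPrime L hL, S2n_eq, ClosedExp.gres_zero, B1.gres_neg]; ring
  · rw [ClosedExp.sum_torPrime L hL, ClosedExp.T10n_eq, ClosedExp.gres_zero, neg_add_cancel, ClosedExp.gres_zero]; ring
  · rw [ClosedExp.sum_torPrime L hL, S1n_eq, ClosedExp.gres_zero, B1.gres_neg]; ring
  · rw [ClosedExp.sum_torPrime L hL, ClosedExp.sum_shift_K1 L (gres L lam2), S1n_eq, zero_add, neg_add_cancel,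
      ClosedExp.gres_zero]; ring

/-- ★ the `B` tail majorant summed over `T′` in named form. -/
theorem sum_torPrime_bMaj (hL : 2 ≤ L) :
    let κ := kapHat L Δ lam2 f 2 + 2 * aPar L Δ f * cS L Δ lam2 f / (L : ℝ) ^ 2
    let c := cS L Δ lam2 f
    let d := dPar L Δ f
    let g1 := gres L lam2 (K1 L)
    ∑ k ∈ torPrime L, bMaj L Δ lam2 f k
      = (12 * c ^ 2 * κ + 6 * c * κ ^ 2 + κ ^ 3) * G21n L lam2 + (4 * c * d * κ + d * κ ^ 2) * (S2n L lam2 - g1 ^ 2)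
        + (8 * c * d * κ + 2 * d * κ ^ 2) * T10n L lam2 + 3 * d ^ 2 * κ * (S1n L lam2 - g1) := by
  intro κ c d g1
  obtain ⟨e1, e2, e3, e4, e5⟩ := sum_torPrime_basic L lam2 hL
  have h : ∀ k : Tor L, bMaj L Δ lam2 f k
      = (12 * c ^ 2 * κ + 6 * c * κ ^ 2 + κ ^ 3) * (gres L lam2 k ^ 2 * gres L lam2 (k + K1 L))
        + (4 * c * d * κ + d * κ ^ 2) * gres L lam2 k ^ 2
        + (8 * c * d * κ + 2 * d * κ ^ 2) * (gres L lam2 k * gres L lam2 (k + K1 L))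
        + (2 * d ^ 2 * κ) * gres L lam2 k + (d ^ 2 * κ) * gres L lam2 (k + K1 L) := by
    intro k; unfold bMaj; ring
  rw [Finset.sum_congr rfl (fun k _ => h k), Finset.sum_add_distrib, Finset.sum_add_distrib, Finset.sum_add_distrib,
    Finset.sum_add_distrib, ← Finset.mul_sum, ← Finset.mul_sum, ← Finset.mul_sum, ← Finset.mul_sum, ← Finset.mul_sum,
    e1, e2, e3, e4, e5]
  ring

/-! ## The pieces of the `B̂` bracket at the true vector -/

/-- base coordinates `7, 9` of the true vector (`T̂10`, `Ĝ21`). -/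
theorem xTrue_79 (a : ℝ) :
    xTrue L Δ lam2 f a 7 = (2 * Real.pi / L) ^ (2 * 2) * T10n L lam2 ∧
      xTrue L Δ lam2 f a 9 = (2 * Real.pi / L) ^ (2 * 3) * G21n L lam2 := by
  refine ⟨?_, ?_⟩ <;> (rw [xTrue_lt16 L Δ lam2 f a (by norm_num)]; rfl)

/-- `g1h ↦ θ²g(K₁)`. -/
theorem eval_g1h (a : ℝ) : (g1h 3).eval (xTrue L Δ lam2 f a) = (2 * Real.pi / L) ^ 2 * gres L lam2 (K1 L) := by
  unfold g1h
  rw [eval_vG L Δ lam2 f axis_mem_gridPts_three.1 a, ClosedExp.toTor_one_zero]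

/-- `BclosedFullC ↦ θ⁶Σ_{T′} c(k)²c(k′)` (`BClosedExpansion`; the corrected term of `…N1RowExprB2`). -/
theorem eval_BclosedFullC (hL : 5 ≤ L) (hΔ0 : 0 ≤ Δ) (hΔ1 : Δ < 1) (hf : IsGroundTwoMagnon L Δ lam2 f) (hlam : 0 < lam2)
    (h1 : lam2 < eps1 L) (hu : 0 < cS L Δ lam2 f * Gzero L lam2) :
    (BclosedFullC 3).eval (xTrue L Δ lam2 f (Δ * f (K1 L)))
      = ((2 * Real.pi / L) ^ 2) ^ 3 * ∑ k ∈ torPrime L, cK L Δ lam2 f k ^ 2 * cK L Δ lam2 f (k + K1 L) := by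
  set X := xTrue L Δ lam2 f (Δ * f (K1 L)) with hXdef
  obtain ⟨_, dcs, _, ddd, _⟩ := dict_at_xTrue L Δ lam2 f hL hΔ0 hΔ1 hf hlam
  obtain ⟨hX1, hX4, _⟩ : X 1 = Real.pi ^ 2 ∧ X 4 = (2 * Real.pi / L) ^ (2 * 2) * S2n L lam2 ∧
      X 5 = (2 * Real.pi / L) ^ (2 * 3) * S3n L lam2 := xTrue_145 L Δ lam2 f (Δ * f (K1 L))
  obtain ⟨hX7, hX9⟩ : X 7 = (2 * Real.pi / L) ^ (2 * 2) * T10n L lam2 ∧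
      X 9 = (2 * Real.pi / L) ^ (2 * 3) * G21n L lam2 := xTrue_79 L Δ lam2 f (Δ * f (K1 L))
  have hX0 : X 0 = (2 * Real.pi / L) ^ 2 := xTrue_zero L Δ lam2 f _
  have hS1 : S1h.eval X = (2 * Real.pi / L) ^ 2 * S1n L lam2 := S1h_eval L Δ lam2 f hL hΔ0 hΔ1 hf hlam hu
  have hg1 : (g1h 3).eval X = (2 * Real.pi / L) ^ 2 * gres L lam2 (K1 L) := eval_g1h L Δ lam2 f _
  have hLpos : (0 : ℝ) < L := by exact_mod_cast (show 0 < L by omega)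
  have hexp := bClosedExpansion_holds L Δ lam2 f hlam h1
  dsimp only at hexp
  rw [hexp]
  have e : (BclosedFullC 3).eval X = -(8 * cs.eval X ^ 3 * X 9 + 4 * cs.eval X ^ 2 * (dd.eval X * X 0) * (X 4 - (g1h 3).eval X ^ 2)
      + 8 * cs.eval X ^ 2 * (dd.eval X * X 0) * X 7 + 6 * cs.eval X * (dd.eval X * X 0) ^ 2 * (S1h.eval X - (g1h 3).eval X)
      + (dd.eval X * X 0) ^ 2 * dd.eval X * (4 * X 1 - 2 * X 0)) := by
    simp only [BclosedFullC, Sg2, Sg1, Dt, vG21, vT10, rsum, cube, RExpr.eval, cst, vS2, vT, vPi2]; push_cast; ring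
  rw [e, dcs, ddd, hX0, hX1, hX4, hX7, hX9, hS1, hg1]
  unfold dPar
  have hπ2 : Real.pi ^ 2 = (2 * Real.pi / (L : ℝ)) ^ 2 * (L : ℝ) ^ 2 / 4 := by
    field_simp
    ring
  rw [hπ2, pow_mul, pow_mul]
  ring

/-- `BtailFull ↦ θ⁶Σ_{T′} bMaj(k)`. -/
theorem eval_BtailFull (hL : 12 ≤ L) (hΔ0 : 0 ≤ Δ) (hΔ1 : Δ < 1) (hf : IsGroundTwoMagnon L Δ lam2 f) (hlam : 0 < lam2)
    (h2 : 2 * lam2 < eps1 L) (hu : 0 < cS L Δ lam2 f * Gzero L lam2) :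
    (BtailFull 3).eval (xTrue L Δ lam2 f (Δ * f (K1 L)))
      = ((2 * Real.pi / L) ^ 2) ^ 3 * ∑ k ∈ torPrime L, bMaj L Δ lam2 f k := by
  set X := xTrue L Δ lam2 f (Δ * f (K1 L)) with hXdef
  obtain ⟨_, dcs, _, ddd, _⟩ := dict_at_xTrue L Δ lam2 f (by omega) hΔ0 hΔ1 hf hlam
  obtain ⟨_, hX4, _⟩ : X 1 = Real.pi ^ 2 ∧ X 4 = (2 * Real.pi / L) ^ (2 * 2) * S2n L lam2 ∧
      X 5 = (2 * Real.pi / L) ^ (2 * 3) * S3n L lam2 := xTrue_145 L Δ lam2 f (Δ * f (K1 L))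
  obtain ⟨hX7, hX9⟩ : X 7 = (2 * Real.pi / L) ^ (2 * 2) * T10n L lam2 ∧
      X 9 = (2 * Real.pi / L) ^ (2 * 3) * G21n L lam2 := xTrue_79 L Δ lam2 f (Δ * f (K1 L))
  have hX0 : X 0 = (2 * Real.pi / L) ^ 2 := xTrue_zero L Δ lam2 f _
  have hS1 : S1h.eval X = (2 * Real.pi / L) ^ 2 * S1n L lam2 := S1h_eval L Δ lam2 f (by omega) hΔ0 hΔ1 hf hlam hu
  have hg1 : (g1h 3).eval X = (2 * Real.pi / L) ^ 2 * gres L lam2 (K1 L) := eval_g1h L Δ lam2 f _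
  have hk : kap.eval X = _ := kap_eval L Δ lam2 f hL hΔ0 hΔ1 hf hlam h2 hu
  have e : (BtailFull 3).eval X
      = 2 * kap.eval X * (4 * cs.eval X ^ 2 * X 9 + 2 * cs.eval X * (dd.eval X * X 0) * (X 4 - (g1h 3).eval X ^ 2)
          + 2 * cs.eval X * (dd.eval X * X 0) * X 7 + (dd.eval X * X 0) ^ 2 * (S1h.eval X - (g1h 3).eval X))
        + kap.eval X * (4 * cs.eval X ^ 2 * X 9 + 4 * cs.eval X * (dd.eval X * X 0) * X 7
          + (dd.eval X * X 0) ^ 2 * (S1h.eval X - (g1h 3).eval X))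
        + kap.eval X ^ 2 * (2 * cs.eval X * X 9 + (dd.eval X * X 0) * (X 4 - (g1h 3).eval X ^ 2)
          + 2 * (2 * cs.eval X * X 9 + (dd.eval X * X 0) * X 7))
        + kap.eval X ^ 3 * X 9 := by
    simp only [BtailFull, Sg2, Sg1, Dt, vG21, vT10, rsum, cube, RExpr.eval, cst, vS2, vT]; push_cast; ring
  have hsum := sum_torPrime_bMaj L Δ lam2 f (by omega)
  dsimp only at hsum
  rw [e, hk, dcs, ddd, hX0, hX4, hX7, hX9, hS1, hg1, hsum]
  unfold dPar
  rw [pow_mul, pow_mul]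
  ring

/-- `BtailAt q ↦ θ⁶·bMaj(k)` on the pair block (`q`, `q + x̂` grid points). -/
theorem eval_BtailAt (hL : 12 ≤ L) (hΔ0 : 0 ≤ Δ) (hΔ1 : Δ < 1) (hf : IsGroundTwoMagnon L Δ lam2 f) (hlam : 0 < lam2)
    (h2 : 2 * lam2 < eps1 L) (hu : 0 < cS L Δ lam2 f * Gzero L lam2) {q : ℤ × ℤ} (hq : q ∈ gridPts 3)
    (hq' : (q.1 + 1, q.2) ∈ gridPts 3) :
    (BtailAt 3 q).eval (xTrue L Δ lam2 f (Δ * f (K1 L))) = ((2 * Real.pi / L) ^ 2) ^ 3 * bMaj L Δ lam2 f (B1.toTor L q) := by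
  set X := xTrue L Δ lam2 f (Δ * f (K1 L)) with hXdef
  have hk : kap.eval X = _ := kap_eval L Δ lam2 f hL hΔ0 hΔ1 hf hlam h2 hu
  obtain ⟨_, hac, _⟩ := eval_closed L Δ lam2 f (by omega) hΔ0 hΔ1 hf hlam hq
  obtain ⟨_, hac', _⟩ := eval_closed L Δ lam2 f (by omega) hΔ0 hΔ1 hf hlam hq'
  have hG := eval_vG L Δ lam2 f hq (Δ * f (K1 L))
  have hG' := eval_vG L Δ lam2 f hq' (Δ * f (K1 L))
  rw [toTor_shift] at hac' hG'
  have e : (BtailAt 3 q).eval X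
      = 2 * kap.eval X * (ach 3 q).eval X * (ach 3 (q.1 + 1, q.2)).eval X * (vG 3 q).eval X
        + kap.eval X * (ach 3 q).eval X ^ 2 * (vG 3 (q.1 + 1, q.2)).eval X
        + kap.eval X ^ 2 * ((vG 3 q).eval X ^ 2 * (ach 3 (q.1 + 1, q.2)).eval X
            + 2 * (ach 3 q).eval X * (vG 3 q).eval X * (vG 3 (q.1 + 1, q.2)).eval X)
        + kap.eval X ^ 3 * ((vG 3 q).eval X ^ 2 * (vG 3 (q.1 + 1, q.2)).eval X) := by
    simp only [BtailAt, rsum, cube, RExpr.eval, cst]; push_cast; ring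
  rw [e, hk, hac, hac', hG, hG']
  unfold bMaj
  ring

/-! ## ★ The object `B̂` is in its bracket -/

/-- ★★ **`B̂ = θ⁶Σ_k F₂(k)² F₂(k + K₁) ∈ [B2loC, B2hiC]` at the true vector** (corrected bracket of `…N1RowExprB2`) (ground profile, `L ≥ 16`, `0 ≤ Δ < 1`,
`c_sG̃(0) > 0`). -/
theorem bHat_mem (hL : 16 ≤ L) (hΔ0 : 0 ≤ Δ) (hΔ1 : Δ < 1) (hf : IsGroundTwoMagnon L Δ lam2 f) (hlam : 0 < lam2)
    (h2 : 2 * lam2 < eps1 L) (hu : 0 < cS L Δ lam2 f * Gzero L lam2) :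
    (B2loC 2).eval (xTrue L Δ lam2 f (Δ * f (K1 L)))
        ≤ ((2 * Real.pi / L) ^ 2) ^ 3 * ∑ k : Tor L, F2 L f k ^ 2 * F2 L f (k + K1 L) ∧
    ((2 * Real.pi / L) ^ 2) ^ 3 * ∑ k : Tor L, F2 L f k ^ 2 * F2 L f (k + K1 L)
        ≤ (B2hiC 2).eval (xTrue L Δ lam2 f (Δ * f (K1 L))) := by
  classical
  set X := xTrue L Δ lam2 f (Δ * f (K1 L)) with hXdef
  set t : ℝ := (2 * Real.pi / L) ^ 2 with htdef
  have hLpos : (0 : ℝ) < L := by exact_mod_cast (show 0 < L by omega)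
  have ht0 : 0 ≤ t := by positivity
  have ht3 : 0 ≤ t ^ 3 := by positivity
  -- the pieces
  have hF0 : F0h.eval X = t * F2 L f 0 := eval_F0h L Δ lam2 f (by omega) hΔ0 hΔ1 hf hlam
  have hFp : (Fh 3 ((1 : ℤ), (0 : ℤ))).eval X = t * F2 L f (K1 L) := by
    rw [hXdef, eval_Fh L Δ lam2 f (by omega) hΔ0 hΔ1 hf hlam axis_mem_gridPts_three.1, ClosedExp.toTor_one_zero]
  have hFm : (Fh 3 ((-1 : ℤ), (0 : ℤ))).eval X = t * F2 L f (-K1 L) := by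
    rw [hXdef, eval_Fh L Δ lam2 f (by omega) hΔ0 hΔ1 hf hlam axis_mem_gridPts_three.2, OuterMaj.toTor_neg_one_zero]
  have hFh : ∀ q ∈ blockP 2, (Fh 3 q).eval X = t * F2 L f (B1.toTor L q) :=
    fun q hq => eval_Fh L Δ lam2 f (by omega) hΔ0 hΔ1 hf hlam (blockP_two_grid q hq).1
  have hFh' : ∀ q ∈ blockP 2, (Fh 3 (q.1 + 1, q.2)).eval X = t * F2 L f (B1.toTor L q + K1 L) := by
    intro q hq
    rw [hXdef, eval_Fh L Δ lam2 f (by omega) hΔ0 hΔ1 hf hlam (blockP_two_grid q hq).2, toTor_shift]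
  have hch : ∀ q ∈ blockP 2, (ch 3 q).eval X = t * cK L Δ lam2 f (B1.toTor L q) :=
    fun q hq => (eval_closed L Δ lam2 f (by omega) hΔ0 hΔ1 hf hlam (blockP_two_grid q hq).1).1
  have hch' : ∀ q ∈ blockP 2, (ch 3 (q.1 + 1, q.2)).eval X = t * cK L Δ lam2 f (B1.toTor L q + K1 L) := by
    intro q hq
    have := (eval_closed L Δ lam2 f (by omega) hΔ0 hΔ1 hf hlam (blockP_two_grid q hq).2).1
    rw [toTor_shift] at this
    exact this
  have htl : ∀ q ∈ blockP 2, (BtailAt 3 q).eval X = t ^ 3 * bMaj L Δ lam2 f (B1.toTor L q) :=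
    fun q hq => eval_BtailAt L Δ lam2 f (by omega) hΔ0 hΔ1 hf hlam h2 hu (blockP_two_grid q hq).1 (blockP_two_grid q hq).2
  have hcl : (BclosedFullC 3).eval X = t ^ 3 * ∑ k ∈ torPrime L, cK L Δ lam2 f k ^ 2 * cK L Δ lam2 f (k + K1 L) :=
    eval_BclosedFullC L Δ lam2 f (by omega) hΔ0 hΔ1 hf hlam (by linarith) hu
  have htf : (BtailFull 3).eval X = t ^ 3 * ∑ k ∈ torPrime L, bMaj L Δ lam2 f k :=
    eval_BtailFull L Δ lam2 f (by omega) hΔ0 hΔ1 hf hlam h2 hu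
  -- block list sums ↦ Finset sums
  have bF : ((blockP 2).map fun q => (RExpr.mul (.sq (Fh 3 q)) (Fh 3 (q.1 + 1, q.2))).eval X).sum
      = t ^ 3 * ∑ k ∈ Fibre3.blockP L 2, F2 L f k ^ 2 * F2 L f (k + K1 L) := by
    rw [blockP_sum_eq L (by omega), ← List.sum_map_mul_left]
    refine congrArg List.sum (List.map_congr_left fun q hq => ?_)
    simp only [RExpr.eval]; rw [hFh q hq, hFh' q hq]; ring
  have bC : ((blockP 2).map fun q => (RExpr.mul (.sq (ch 3 q)) (ch 3 (q.1 + 1, q.2))).eval X).sum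
      = t ^ 3 * ∑ k ∈ Fibre3.blockP L 2, cK L Δ lam2 f k ^ 2 * cK L Δ lam2 f (k + K1 L) := by
    rw [blockP_sum_eq L (by omega), ← List.sum_map_mul_left]
    refine congrArg List.sum (List.map_congr_left fun q hq => ?_)
    simp only [RExpr.eval]; rw [hch q hq, hch' q hq]; ring
  have bT : ((blockP 2).map fun q => (BtailAt 3 q).eval X).sum = t ^ 3 * ∑ k ∈ Fibre3.blockP L 2, bMaj L Δ lam2 f k := by
    rw [blockP_sum_eq L (by omega), ← List.sum_map_mul_left]
    exact congrArg List.sum (List.map_congr_left fun q hq => htl q hq)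
  -- the brackets evaluated
  have ecore : (B2coreC 2).eval X = t ^ 3 * (F2 L f 0 ^ 2 * F2 L f (K1 L) + F2 L f (-K1 L) ^ 2 * F2 L f 0
      + ∑ k ∈ Fibre3.blockP L 2, F2 L f k ^ 2 * F2 L f (k + K1 L)
      + (∑ k ∈ torPrime L, cK L Δ lam2 f k ^ 2 * cK L Δ lam2 f (k + K1 L)
        - ∑ k ∈ Fibre3.blockP L 2, cK L Δ lam2 f k ^ 2 * cK L Δ lam2 f (k + K1 L))) := by
    simp only [B2coreC, rsum, RExpr.eval, eval_rsum, List.map_map, Nat.reduceAdd]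
    rw [hF0, hFp, hFm, hcl]
    have h1 : (List.map ((fun e => e.eval X) ∘ fun q : ℤ × ℤ => RExpr.mul (.sq (Fh 3 q)) (Fh 3 (q.1 + 1, q.2)))
        (blockP 2)).sum = t ^ 3 * ∑ k ∈ Fibre3.blockP L 2, F2 L f k ^ 2 * F2 L f (k + K1 L) := by rw [← bF]; rfl
    have h2' : (List.map ((fun e => e.eval X) ∘ fun q : ℤ × ℤ => RExpr.mul (.sq (ch 3 q)) (ch 3 (q.1 + 1, q.2)))
        (blockP 2)).sum = t ^ 3 * ∑ k ∈ Fibre3.blockP L 2, cK L Δ lam2 f k ^ 2 * cK L Δ lam2 f (k + K1 L) := by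
      rw [← bC]; rfl
    rw [h1, h2']; ring
  have etail : (B2tail 2).eval X = max (t ^ 3 * (∑ k ∈ torPrime L, bMaj L Δ lam2 f k
      - ∑ k ∈ Fibre3.blockP L 2, bMaj L Δ lam2 f k)) 0 := by
    simp only [B2tail, RExpr.eval, eval_rsum, List.map_map, cst, Nat.reduceAdd]
    have h3 : (List.map ((fun e => e.eval X) ∘ fun q => BtailAt 3 q) (blockP 2)).sum
        = t ^ 3 * ∑ k ∈ Fibre3.blockP L 2, bMaj L Δ lam2 f k := by rw [← bT]; rfl
    rw [htf, h3]; push_cast; congr 1; ring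
  have ehi : (B2hiC 2).eval X = (B2coreC 2).eval X + (B2tail 2).eval X := by simp only [B2hiC, RExpr.eval]
  have elo : (B2loC 2).eval X = (B2coreC 2).eval X - (B2tail 2).eval X := by simp only [B2loC, RExpr.eval]
  -- the true sum decomposed
  have split := OuterMaj.pairRegionSplit_holds L 2 (by omega) (fun k => F2 L f k ^ 2 * F2 L f (k + K1 L))
  have hout : ∑ k ∈ Fibre3.outerP L 2, F2 L f k ^ 2 * F2 L f (k + K1 L)
      = (∑ k ∈ torPrime L, cK L Δ lam2 f k ^ 2 * cK L Δ lam2 f (k + K1 L)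
          - ∑ k ∈ Fibre3.blockP L 2, cK L Δ lam2 f k ^ 2 * cK L Δ lam2 f (k + K1 L))
        + ∑ k ∈ Fibre3.outerP L 2, (F2 L f k ^ 2 * F2 L f (k + K1 L) - cK L Δ lam2 f k ^ 2 * cK L Δ lam2 f (k + K1 L)) := by
    rw [← outerP_sum_eq L (by omega), ← Finset.sum_add_distrib]
    refine Finset.sum_congr rfl fun k _ => ?_; ring
  have hbd := OuterMaj.b_outer_bound L (by omega) hΔ0 hΔ1 hf 2 (by omega)
    (OuterMaj.f2ClosedPlusTail_holds L (by omega) hΔ0) (OuterMaj.outerEnergyFloor_holds L 2)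
  have hmaj : ∑ k ∈ Fibre3.outerP L 2, bMaj L Δ lam2 f k
      = ∑ k ∈ torPrime L, bMaj L Δ lam2 f k - ∑ k ∈ Fibre3.blockP L 2, bMaj L Δ lam2 f k :=
    outerP_sum_eq L (by omega) _
  have habs : |∑ k ∈ Fibre3.outerP L 2, (F2 L f k ^ 2 * F2 L f (k + K1 L) - cK L Δ lam2 f k ^ 2 * cK L Δ lam2 f (k + K1 L))|
      ≤ ∑ k ∈ Fibre3.outerP L 2, bMaj L Δ lam2 f k := by
    refine hbd.trans (le_of_eq ?_)
    refine Finset.sum_congr rfl fun k _ => ?_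
    unfold bMaj; ring
  rw [hmaj] at habs
  obtain ⟨hlow, hupp⟩ := abs_le.1 habs
  have key : t ^ 3 * ∑ k : Tor L, F2 L f k ^ 2 * F2 L f (k + K1 L)
      = t ^ 3 * (F2 L f 0 ^ 2 * F2 L f (K1 L) + F2 L f (-K1 L) ^ 2 * F2 L f 0
        + ∑ k ∈ Fibre3.blockP L 2, F2 L f k ^ 2 * F2 L f (k + K1 L)
        + (∑ k ∈ torPrime L, cK L Δ lam2 f k ^ 2 * cK L Δ lam2 f (k + K1 L)
          - ∑ k ∈ Fibre3.blockP L 2, cK L Δ lam2 f k ^ 2 * cK L Δ lam2 f (k + K1 L)))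
        + t ^ 3 * ∑ k ∈ Fibre3.outerP L 2,
            (F2 L f k ^ 2 * F2 L f (k + K1 L) - cK L Δ lam2 f k ^ 2 * cK L Δ lam2 f (k + K1 L)) := by
    rw [split, hout, zero_add, neg_add_cancel]; ring
  rw [ehi, elo, ecore, etail, key]
  have hm1 := le_max_left (t ^ 3 * (∑ k ∈ torPrime L, bMaj L Δ lam2 f k
          - ∑ k ∈ Fibre3.blockP L 2, bMaj L Δ lam2 f k)) 0
  have hA := mul_le_mul_of_nonneg_left hupp ht3
  have hB := mul_le_mul_of_nonneg_left hlow ht3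
  constructor
  · linarith [hm1, hB]
  · linarith [hm1, hA]

end Summit.HubbardSuperconductivity.HubbardSuperconductivity.Theorems.AnisotropyChord.Transfer.Fibre3.L2.N1
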